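import Summits.HodgeConjecture.HodgeConjecture.Cruxes.H413.Lines.K2_E4_SingularTransferKappaSign                              -- tier 0: stubs A–D (BY WRITE; ED. 2 227b0a5e9baeb032: + pinned twins A_R, B_R)
import Summits.HodgeConjecture.HodgeConjecture.Cruxes.H413.Lines.K2_E4_SingularTransferKappaSignSigsFinSingularTransferExplicit  -- #3′ `sig_K2E4ExplicitNonsplitSingularTransferU` (ED. 2)
import Summits.HodgeConjecture.HodgeConjecture.Cruxes.H413.Lines.K2_E4_SingularTransferKappaSignSigsArchLimitConstant            -- #9 `sig_K2E4ExplicitArchSingularTransfer` (ED. 3)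
import Summits.HodgeConjecture.HodgeConjecture.Cruxes.H413.Lines.K2_E4_SingularTransferKappaSignSigsWeakMatrixRigidity           -- (ED. 3) #21 `sig_K2E4WeakMatrixArchTransport`, #22∕#22S∕#22N `sig_K2E4WeakMatrixFiniteTransport`
import Summits.HodgeConjecture.HodgeConjecture.Cruxes.H413.Lines.K2_E4_SingularTransferKappaSignSigsSplitDescent             -- #1′ `sig_K2E4ExplicitSplitSingularTransferU` (ED. 2)
import Summits.HodgeConjecture.HodgeConjecture.Cruxes.H413.Lines.K2_E4_SingularTransferKappaSignSigsSingularProductFormula   -- #14 `sig_K2E4ExplicitKappaSign`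
import Summits.HodgeConjecture.HodgeConjecture.Cruxes.H413.Lines.K2_E4_SingularTransferKappaSignSigsFinGermConstants         -- #8 `sig_K2E4KottwitzSignOfSheets`
import Summits.HodgeConjecture.HodgeConjecture.Theorems.K2E4StubAOfSockets   -- ★ p854848 (K2E4-p21): C3′ `stubA_of_sockets`
import Summits.HodgeConjecture.HodgeConjecture.Theorems.K2E4ExplicitKappaSignOfSockets   -- ★ p854898 (K2E4-p14): ‹#2› → ‹#8› → ‹#13R› → ‹#10♯› → ‹#14› (= B_R)
import Summits.HodgeConjecture.HodgeConjecture.Theorems.K2E4StubCOfSockets   -- ★ p854908 (K2E4-p17): C1′ `stubC_of_sockets`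
import Summits.HodgeConjecture.HodgeConjecture.Theorems.K2E4StubCOfSocketsSplit   -- ★ p855380 (K2E4-p17 (g2)): C1′ over #22S `stubC_of_socketsSplit` (edition 5)
import Summits.HodgeConjecture.HodgeConjecture.Theorems.K2E4StubDOfSockets   -- ★ p854859 (K2E4-p05): C2′ `stubD_of_sockets`
import HarnessLib

/-!
# K2 · E4 — COMPOSITION CERTIFICATES (chair RULING R10 (ii) 21:19:25Z): the tier-0 stubs FROM the tier-1 sockets, BY NAME

Track B ∕ h413, line `Cruxes/H413/Lines/K2_E4_SingularTransferKappaSign.lean` (tier 0: stubs A `stub_archSingularKappaTransfer`, B `stub_kappaSignOfPinnedConstants`,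
C `stub_finSingularKappaTransferSplit`, D `stub_finSingularKappaTransferNonsplit`; heads `archKappaSign_of_line` ⊢ O7 and `kappaLocOmega_of_line` ⊢ X2♮ verbatim).
This module is the E4 analogue of the E1b∕E2∕E3 `*_of_sigs` certificates: each theorem below takes the ACTUAL socket theorems of the `…Sigs*` modules (still OPEN stubs
there; here they enter only as HYPOTHESIS TYPES via `type_of%`, so this file has no proof holes and its axioms are the kernel TRIO) and concludes the type of the ACTUAL tier-0 stub
(`type_of%` of the stub constant) — by ONE application of the ★ composition theorem landed under `Theorems/`.  Nothing is restated by hand except the closed «explicit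
edge» hypothesis `hE` of C3′, pasted token for token from ★ `Theorems/K2E4StubAOfSockets.lean`.

EDITION 5 (2026-09-03 23:1xZ, after ★ `Theorems/K2E4StubCOfSocketsSplit.lean` p855380 landed): + the ‹#22N›-FREE C1′ certificate `stubC_of_sigsSplit : ‹#1′› → ‹#22S› → ‹stub C›`
BY NAME (stub C needs only the SPLIT half of #22; the non-split half #22N feeds stub D∕A only through #22 = `sig22_of_halves`).  EDITION 4 (2026-09-03 22:4xZ, after WeakMatrixRigidity ED. 3 split #22 into #22S∕#22N per K2E4-p18 (g2) REPORT-22): + `sig22_of_halves : ‹#22S› → ‹#22N› → ‹#22›`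
(`by_cases` on `Subsingleton (UnitaryGroup.PlacesOver L v)`) ; the ‹#22N›-FREE C1′ certificate `stubC_of_sigsSplit : ‹#1′› → ‹#22S› → ‹stub C›` lands in EDITION 5 when K2E4-p17 (g2)'s
★ `Theorems/K2E4StubCOfSocketsSplit.lean` (C1′ re-typed over #22S) is in the tree.  EDITION 3 (2026-09-03 22:2xZ, after ArchLimitConstant ED. 5 typed socket #10♯): + `stubBR_of_sockets4 : ‹#2› → ‹#8› → ‹#13R› → ‹#10♯› → ‹B_R›` — the composition of the
pinned κ-sign stub from its four open sockets BY NAME, proof = ★ `K2E4ExplicitKappaSignOfSockets.explicitKappaSign_of_sockets` (K2E4-p14 p854898) re-bound under the common 20-binder prefix.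
EDITION 2 (2026-09-03, after tier-0 ED. 2 ∕ chair R13′): + `stubC_of_sigs` (C1′: ‹#1′› → ‹#22› → ‹C›, ★ `K2E4StubCOfSockets.stubC_of_sockets`, K2E4-p17 p854908) and the
IDENTITY certificates of R13′ «A_R = #9 by name, B_R = #14 by name»: `stubAR_of_sigs : ‹#9› → ‹A_R› := fun h => h`, `stubBR_of_sigs : ‹#14› → ‹B_R› := fun h => h`
(the pinned twins' bytes ARE the sockets' bytes token for token — definitional, kernel-checked here).  EDITION 1 (2026-09-03): `stubD_of_sigs` (C2′: ‹#3′› → ‹#22› → ‹D›, ★ `K2E4StubDOfSockets.stubD_of_sockets`, K2E4-p05 p854859) and `stubA_of_sigs` (C3′: hE → ‹#9 closed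
over `Tinf`› → ‹#21› → ‹A›, ★ `K2E4StubAOfSockets.stubA_of_sockets`, K2E4-p21 p854848).  WEAK `stubB_of_sigs` WILL NOT FOLLOW: weak stub B is dead on the weak frame (K2E4-r01); B_R is composed instead (`stubBR_of_sockets4`). Formerly planned: `stubB_of_sigs` (C4′: ★ `K2E4StubBOfSockets.kappaSignOfPinnedConstants_tamagawa_of_sockets`, K2E4-p16 p854869 — concludes B's body for the
|ω|-Tamagawa singular systems; the by-name form waits for the chair's (b)∕(c) reading of p16's 21:17:40Z finding).

HONEST LABEL.  These certificates prove IMPLICATIONS between typed statements; every socket is still open unless ★ elsewhere, and the explicit edge `hE` (resp. the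
μ-guard inside C2′, ★ `exists_isUnitary_isSplittingChar_one`) is exactly what rung 0's data supplies.  HC_CM is proved only modulo the 7 printed citations (2 remaining
named inputs: hLiu418 = stmt-HodgeConjecture-24832, h413 = stmt-HodgeConjecture-24833) until rung 0 closes.
[cite: Rogawski1990, Prop. 8.2.1 (a) pp. 117–118; Lemma 14.5.2 (b) pp. 238–239]
-/

set_option autoImplicit false
set_option linter.dupNamespace false

noncomputable section

open MeasureTheory Measure NumberField IsDedekindDomain
open Literature.MeasureTheory.Group Literature.MeasureTheory.RestrictedProduct
open Literature.Topology.RestrictedProduct Literature.Topology.Algebra.RestrictedProduct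
open Literature.NumberTheory.Rogawski1990 Literature.NumberTheory.Automorphic
open Literature.AlgebraicGeometry.ShimuraVarieties (unitaryGroup hermForm)
open scoped Matrix MatrixGroups RestrictedProduct


namespace Summit.HodgeConjecture.HodgeConjecture.Cruxes.H413.K2E4SingularTransferKappaSign.Compositions

section Frame

variable (L : Type) [Field L] [NumberField L] [IsCMField L]

variable (H' : Matrix (Fin 3) (Fin 3) L) (Tinf : ArchTransferFactor L H')
    -- σ-algebras of the `G′` side (★ (O10-c5) block), of `H_v`, `G_∞`, `H_∞`, and the Haar data — EXACTLY ★ `SingularEllipticTransfer`'s binders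
    [∀ g : (UnitaryGroup.cmDatum L 3 H').Adelic, MeasurableSpace ((UnitaryGroup.cmDatum L 3 H').Adelic ⧸ Subgroup.centralizer ({g} : Set (UnitaryGroup.cmDatum L 3 H').Adelic))]
    [∀ g : (UnitaryGroup.cmDatum L 3 H').Adelic, BorelSpace ((UnitaryGroup.cmDatum L 3 H').Adelic ⧸ Subgroup.centralizer ({g} : Set (UnitaryGroup.cmDatum L 3 H').Adelic))]
    [∀ γ : UnitaryGroup.arch (↥(maximalRealSubfield L)) L (IsCMField.complexConj L) 3 H',
      MeasurableSpace (UnitaryGroup.arch (↥(maximalRealSubfield L)) L (IsCMField.complexConj L) 3 H' ⧸ Subgroup.centralizer ({γ} : Set (UnitaryGroup.arch (↥(maximalRealSubfield L)) L (IsCMField.complexConj L) 3 H')))]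
    [∀ γ : UnitaryGroup.arch (↥(maximalRealSubfield L)) L (IsCMField.complexConj L) 3 H',
      BorelSpace (UnitaryGroup.arch (↥(maximalRealSubfield L)) L (IsCMField.complexConj L) 3 H' ⧸ Subgroup.centralizer ({γ} : Set (UnitaryGroup.arch (↥(maximalRealSubfield L)) L (IsCMField.complexConj L) 3 H')))]
    [∀ (v : HeightOneSpectrum (𝓞 ↥(maximalRealSubfield L))) (γ : (UnitaryGroup.cmDatum L 3 H').Local v),
      MeasurableSpace ((UnitaryGroup.cmDatum L 3 H').Local v ⧸ Subgroup.centralizer ({γ} : Set ((UnitaryGroup.cmDatum L 3 H').Local v)))]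
    [∀ (v : HeightOneSpectrum (𝓞 ↥(maximalRealSubfield L))) (γ : (UnitaryGroup.cmDatum L 3 H').Local v),
      BorelSpace ((UnitaryGroup.cmDatum L 3 H').Local v ⧸ Subgroup.centralizer ({γ} : Set ((UnitaryGroup.cmDatum L 3 H').Local v)))]
    [∀ v : HeightOneSpectrum (𝓞 ↥(maximalRealSubfield L)), MeasurableSpace ((UnitaryGroup.cmDatum L 3 H').Local v)] [∀ v : HeightOneSpectrum (𝓞 ↥(maximalRealSubfield L)), BorelSpace ((UnitaryGroup.cmDatum L 3 H').Local v)]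
    [MeasurableSpace (UnitaryGroup.cmDatum L 3 H').Adelic] [BorelSpace (UnitaryGroup.cmDatum L 3 H').Adelic]
    [MeasurableSpace (UnitaryGroup.arch (↥(maximalRealSubfield L)) L (IsCMField.complexConj L) 3 H')] [BorelSpace (UnitaryGroup.arch (↥(maximalRealSubfield L)) L (IsCMField.complexConj L) 3 H')]
    [∀ γ : (UnitaryGroup.cmDatum L 3 H').Adelic, MeasurableSpace (↥(Subgroup.centralizer ({γ} : Set (UnitaryGroup.cmDatum L 3 H').Adelic)) ⧸
      ((UnitaryGroup.cmDatum L 3 H').quotientSubgroup ⊓ Subgroup.centralizer ({γ} : Set (UnitaryGroup.cmDatum L 3 H').Adelic)).subgroupOf (Subgroup.centralizer ({γ} : Set (UnitaryGroup.cmDatum L 3 H').Adelic)))]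
    [∀ γ : (UnitaryGroup.cmDatum L 3 H').Adelic, BorelSpace (↥(Subgroup.centralizer ({γ} : Set (UnitaryGroup.cmDatum L 3 H').Adelic)) ⧸
      ((UnitaryGroup.cmDatum L 3 H').quotientSubgroup ⊓ Subgroup.centralizer ({γ} : Set (UnitaryGroup.cmDatum L 3 H').Adelic)).subgroupOf (Subgroup.centralizer ({γ} : Set (UnitaryGroup.cmDatum L 3 H').Adelic)))]
    [hCcl : ∀ γ : (UnitaryGroup.cmDatum L 3 H').Adelic, IsClosed ((Subgroup.centralizer ({γ} : Set (UnitaryGroup.cmDatum L 3 H').Adelic) : Subgroup (UnitaryGroup.cmDatum L 3 H').Adelic) : Set (UnitaryGroup.cmDatum L 3 H').Adelic)]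
    [∀ γ : (UnitaryGroup.cmDatum L 3 H').Adelic, (count : Measure ↥(((UnitaryGroup.cmDatum L 3 H').quotientSubgroup ⊓ Subgroup.centralizer ({γ} : Set (UnitaryGroup.cmDatum L 3 H').Adelic)).subgroupOf
      (Subgroup.centralizer ({γ} : Set (UnitaryGroup.cmDatum L 3 H').Adelic)))).IsHaarMeasure]
    [∀ v : HeightOneSpectrum (𝓞 ↥(maximalRealSubfield L)), MeasurableSpace ((UnitaryGroup.cmDatum L 2 (Matrix.of fun i j : Fin 2 => if i.val + j.val + 1 = 2 then (1 : L) else 0)).Local v ×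
        (UnitaryGroup.cmDatum L 1 (Matrix.of fun i j : Fin 1 => if i.val + j.val + 1 = 1 then (1 : L) else 0)).Local v)]
    [∀ v : HeightOneSpectrum (𝓞 ↥(maximalRealSubfield L)), BorelSpace ((UnitaryGroup.cmDatum L 2 (Matrix.of fun i j : Fin 2 => if i.val + j.val + 1 = 2 then (1 : L) else 0)).Local v ×
        (UnitaryGroup.cmDatum L 1 (Matrix.of fun i j : Fin 1 => if i.val + j.val + 1 = 1 then (1 : L) else 0)).Local v)]
    [∀ (v : HeightOneSpectrum (𝓞 ↥(maximalRealSubfield L))) (a : ((UnitaryGroup.cmDatum L 2 (Matrix.of fun i j : Fin 2 => if i.val + j.val + 1 = 2 then (1 : L) else 0)).Local v ×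
        (UnitaryGroup.cmDatum L 1 (Matrix.of fun i j : Fin 1 => if i.val + j.val + 1 = 1 then (1 : L) else 0)).Local v)),
      MeasurableSpace (((UnitaryGroup.cmDatum L 2 (Matrix.of fun i j : Fin 2 => if i.val + j.val + 1 = 2 then (1 : L) else 0)).Local v ×
        (UnitaryGroup.cmDatum L 1 (Matrix.of fun i j : Fin 1 => if i.val + j.val + 1 = 1 then (1 : L) else 0)).Local v) ⧸ Subgroup.centralizer ({a} : Set ((UnitaryGroup.cmDatum L 2 (Matrix.of fun i j : Fin 2 => if i.val + j.val + 1 = 2 then (1 : L) else 0)).Local v ×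
        (UnitaryGroup.cmDatum L 1 (Matrix.of fun i j : Fin 1 => if i.val + j.val + 1 = 1 then (1 : L) else 0)).Local v)))]
    [∀ (v : HeightOneSpectrum (𝓞 ↥(maximalRealSubfield L))) (a : ((UnitaryGroup.cmDatum L 2 (Matrix.of fun i j : Fin 2 => if i.val + j.val + 1 = 2 then (1 : L) else 0)).Local v ×
        (UnitaryGroup.cmDatum L 1 (Matrix.of fun i j : Fin 1 => if i.val + j.val + 1 = 1 then (1 : L) else 0)).Local v)),
      BorelSpace (((UnitaryGroup.cmDatum L 2 (Matrix.of fun i j : Fin 2 => if i.val + j.val + 1 = 2 then (1 : L) else 0)).Local v ×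
        (UnitaryGroup.cmDatum L 1 (Matrix.of fun i j : Fin 1 => if i.val + j.val + 1 = 1 then (1 : L) else 0)).Local v) ⧸ Subgroup.centralizer ({a} : Set ((UnitaryGroup.cmDatum L 2 (Matrix.of fun i j : Fin 2 => if i.val + j.val + 1 = 2 then (1 : L) else 0)).Local v ×
        (UnitaryGroup.cmDatum L 1 (Matrix.of fun i j : Fin 1 => if i.val + j.val + 1 = 1 then (1 : L) else 0)).Local v)))]
    [MeasurableSpace (UnitaryGroup.arch (↥(maximalRealSubfield L)) L (IsCMField.complexConj L) 3 (Matrix.of fun i j : Fin 3 => if i.val + j.val + 1 = 3 then (1 : L) else 0))] [BorelSpace (UnitaryGroup.arch (↥(maximalRealSubfield L)) L (IsCMField.complexConj L) 3 (Matrix.of fun i j : Fin 3 => if i.val + j.val + 1 = 3 then (1 : L) else 0))]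
    [∀ γ : UnitaryGroup.arch (↥(maximalRealSubfield L)) L (IsCMField.complexConj L) 3 (Matrix.of fun i j : Fin 3 => if i.val + j.val + 1 = 3 then (1 : L) else 0),
      MeasurableSpace (UnitaryGroup.arch (↥(maximalRealSubfield L)) L (IsCMField.complexConj L) 3 (Matrix.of fun i j : Fin 3 => if i.val + j.val + 1 = 3 then (1 : L) else 0) ⧸ Subgroup.centralizer ({γ} : Set (UnitaryGroup.arch (↥(maximalRealSubfield L)) L (IsCMField.complexConj L) 3 (Matrix.of fun i j : Fin 3 => if i.val + j.val + 1 = 3 then (1 : L) else 0))))]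
    [∀ γ : UnitaryGroup.arch (↥(maximalRealSubfield L)) L (IsCMField.complexConj L) 3 (Matrix.of fun i j : Fin 3 => if i.val + j.val + 1 = 3 then (1 : L) else 0),
      BorelSpace (UnitaryGroup.arch (↥(maximalRealSubfield L)) L (IsCMField.complexConj L) 3 (Matrix.of fun i j : Fin 3 => if i.val + j.val + 1 = 3 then (1 : L) else 0) ⧸ Subgroup.centralizer ({γ} : Set (UnitaryGroup.arch (↥(maximalRealSubfield L)) L (IsCMField.complexConj L) 3 (Matrix.of fun i j : Fin 3 => if i.val + j.val + 1 = 3 then (1 : L) else 0))))]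
    [MeasurableSpace (UnitaryGroup.arch (↥(maximalRealSubfield L)) L (IsCMField.complexConj L) 2 (Matrix.of fun i j : Fin 2 => if i.val + j.val + 1 = 2 then (1 : L) else 0) ×
          UnitaryGroup.arch (↥(maximalRealSubfield L)) L (IsCMField.complexConj L) 1 (Matrix.of fun i j : Fin 1 => if i.val + j.val + 1 = 1 then (1 : L) else 0))]
    [BorelSpace (UnitaryGroup.arch (↥(maximalRealSubfield L)) L (IsCMField.complexConj L) 2 (Matrix.of fun i j : Fin 2 => if i.val + j.val + 1 = 2 then (1 : L) else 0) ×
          UnitaryGroup.arch (↥(maximalRealSubfield L)) L (IsCMField.complexConj L) 1 (Matrix.of fun i j : Fin 1 => if i.val + j.val + 1 = 1 then (1 : L) else 0))]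
    [∀ a : (UnitaryGroup.arch (↥(maximalRealSubfield L)) L (IsCMField.complexConj L) 2 (Matrix.of fun i j : Fin 2 => if i.val + j.val + 1 = 2 then (1 : L) else 0) ×
          UnitaryGroup.arch (↥(maximalRealSubfield L)) L (IsCMField.complexConj L) 1 (Matrix.of fun i j : Fin 1 => if i.val + j.val + 1 = 1 then (1 : L) else 0)),
      MeasurableSpace ((UnitaryGroup.arch (↥(maximalRealSubfield L)) L (IsCMField.complexConj L) 2 (Matrix.of fun i j : Fin 2 => if i.val + j.val + 1 = 2 then (1 : L) else 0) ×
          UnitaryGroup.arch (↥(maximalRealSubfield L)) L (IsCMField.complexConj L) 1 (Matrix.of fun i j : Fin 1 => if i.val + j.val + 1 = 1 then (1 : L) else 0)) ⧸ Subgroup.centralizer ({a} : Set (UnitaryGroup.arch (↥(maximalRealSubfield L)) L (IsCMField.complexConj L) 2 (Matrix.of fun i j : Fin 2 => if i.val + j.val + 1 = 2 then (1 : L) else 0) ×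
          UnitaryGroup.arch (↥(maximalRealSubfield L)) L (IsCMField.complexConj L) 1 (Matrix.of fun i j : Fin 1 => if i.val + j.val + 1 = 1 then (1 : L) else 0))))]
    [∀ a : (UnitaryGroup.arch (↥(maximalRealSubfield L)) L (IsCMField.complexConj L) 2 (Matrix.of fun i j : Fin 2 => if i.val + j.val + 1 = 2 then (1 : L) else 0) ×
          UnitaryGroup.arch (↥(maximalRealSubfield L)) L (IsCMField.complexConj L) 1 (Matrix.of fun i j : Fin 1 => if i.val + j.val + 1 = 1 then (1 : L) else 0)),
      BorelSpace ((UnitaryGroup.arch (↥(maximalRealSubfield L)) L (IsCMField.complexConj L) 2 (Matrix.of fun i j : Fin 2 => if i.val + j.val + 1 = 2 then (1 : L) else 0) ×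
          UnitaryGroup.arch (↥(maximalRealSubfield L)) L (IsCMField.complexConj L) 1 (Matrix.of fun i j : Fin 1 => if i.val + j.val + 1 = 1 then (1 : L) else 0)) ⧸ Subgroup.centralizer ({a} : Set (UnitaryGroup.arch (↥(maximalRealSubfield L)) L (IsCMField.complexConj L) 2 (Matrix.of fun i j : Fin 2 => if i.val + j.val + 1 = 2 then (1 : L) else 0) ×
          UnitaryGroup.arch (↥(maximalRealSubfield L)) L (IsCMField.complexConj L) 1 (Matrix.of fun i j : Fin 1 => if i.val + j.val + 1 = 1 then (1 : L) else 0))))]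
    (νH : ∀ v : HeightOneSpectrum (𝓞 ↥(maximalRealSubfield L)), Measure ((UnitaryGroup.cmDatum L 2 (Matrix.of fun i j : Fin 2 => if i.val + j.val + 1 = 2 then (1 : L) else 0)).Local v ×
        (UnitaryGroup.cmDatum L 1 (Matrix.of fun i j : Fin 1 => if i.val + j.val + 1 = 1 then (1 : L) else 0)).Local v))
    (νG : ∀ v : HeightOneSpectrum (𝓞 ↥(maximalRealSubfield L)), Measure ((UnitaryGroup.cmDatum L 3 H').Local v))
    [∀ v, IsFiniteMeasureOnCompacts (νH v)] [∀ v, (νH v).IsMulRightInvariant]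
    [∀ v, (νG v).IsHaarMeasure] [∀ v, (νG v).IsMulRightInvariant]  -- MAIN-b's strength (F2): `νG_v` Haar
    (νGi : Measure (UnitaryGroup.arch (↥(maximalRealSubfield L)) L (IsCMField.complexConj L) 3 H')) (νqi : Measure (UnitaryGroup.arch (↥(maximalRealSubfield L)) L (IsCMField.complexConj L) 3 (Matrix.of fun i j : Fin 3 => if i.val + j.val + 1 = 3 then (1 : L) else 0)))
    (νHi : Measure (UnitaryGroup.arch (↥(maximalRealSubfield L)) L (IsCMField.complexConj L) 2 (Matrix.of fun i j : Fin 2 => if i.val + j.val + 1 = 2 then (1 : L) else 0) ×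
          UnitaryGroup.arch (↥(maximalRealSubfield L)) L (IsCMField.complexConj L) 1 (Matrix.of fun i j : Fin 1 => if i.val + j.val + 1 = 1 then (1 : L) else 0)))
    [IsFiniteMeasureOnCompacts νGi] [νGi.IsMulRightInvariant] [IsFiniteMeasureOnCompacts νqi] [νqi.IsMulRightInvariant]
    [IsFiniteMeasureOnCompacts νHi] [νHi.IsMulRightInvariant]


set_option maxHeartbeats 16000000 in
set_option synthInstance.maxHeartbeats 800000 in
set_option linter.unusedSectionVars false in
/-- **C2′ certificate — `stubD_of_sigs : ‹#3′› → ‹#22› → ‹stub D›` BY NAME.**  ‹#3′› = `FinSingularTransferExplicit.sig_K2E4ExplicitNonsplitSingularTransferU` (ED. 2,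
= K2E4-p05's bytes 4ff5da2163063b4d), ‹#22› = `WeakMatrixRigidity.sig_K2E4WeakMatrixFiniteTransport`, conclusion = the type of tier-0 `stub_finSingularKappaTransferNonsplit`;
proof = ★ `K2E4StubDOfSockets.stubD_of_sockets` (p854859). -/
theorem stubD_of_sigs :
    type_of% (Summit.HodgeConjecture.HodgeConjecture.Cruxes.H413.K2E4SingularTransferKappaSign.FinSingularTransferExplicit.sig_K2E4ExplicitNonsplitSingularTransferU L H' Tinf νH νG νGi νqi νHi) →
    type_of% (Summit.HodgeConjecture.HodgeConjecture.Cruxes.H413.K2E4SingularTransferKappaSign.WeakMatrixRigidity.sig_K2E4WeakMatrixFiniteTransport L H' Tinf νH νG νGi νqi νHi) →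
    type_of% (Summit.HodgeConjecture.HodgeConjecture.Cruxes.H413.K2E4SingularTransferKappaSign.stub_finSingularKappaTransferNonsplit L H' Tinf νH νG νGi νqi νHi) :=
  fun h3 h22 =>
    Summit.HodgeConjecture.HodgeConjecture.Cruxes.H413.K2E4StubDOfSockets.stubD_of_sockets L H' Tinf νH νG νGi νqi νHi h3 h22

set_option maxHeartbeats 16000000 in
set_option synthInstance.maxHeartbeats 800000 in
set_option linter.unusedSectionVars false in
/-- **C3′ certificate — `stubA_of_sigs : hE → ‹#9, closed over Tinf› → ‹#21› → ‹stub A›` BY NAME.**  `hE` («explicit edge», pasted token for token from ★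
`Theorems/K2E4StubAOfSockets.lean`): at every archimedean frame carrying the weak singular matrix of `Tinf`, SOME unitary Hecke character `μ` extending `ω_{L∕L⁺}` has a
weak-letter `CanonicalTransferMatrix` for its explicit finite collection and the archimedean singular matrix of `Δ‴_∞(μ)` at those families (rung 0's printed inputs;
for genuinely weak `Tinf` the content of unit WeakMatrixRigidity).  ‹#9› = `ArchLimitConstant.sig_K2E4ExplicitArchSingularTransfer` read at every `Tinf`, ‹#21› =
`WeakMatrixRigidity.sig_K2E4WeakMatrixArchTransport`, conclusion = the type of tier-0 `stub_archSingularKappaTransfer`; proof = ★ `K2E4StubAOfSockets.stubA_of_sockets` (p854848). -/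
theorem stubA_of_sigs
    (hE : ∀
        (hanis : ∀ x : Fin 3 → L, hermForm (cmConjRingHom L) H' x x = 0 → x = 0)
        (m' : OrbitalMeasureFamily (UnitaryGroup.arch (↥(maximalRealSubfield L)) L (IsCMField.complexConj L) 3 H'))
        (m : OrbitalMeasureFamily (UnitaryGroup.arch (↥(maximalRealSubfield L)) L (IsCMField.complexConj L) 3
          (Matrix.of fun i j : Fin 3 => if i.val + j.val + 1 = 3 then (1 : L) else 0)))
        (mHi : OrbitalMeasureFamily (UnitaryGroup.arch (↥(maximalRealSubfield L)) L (IsCMField.complexConj L) 2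
            (Matrix.of fun i j : Fin 2 => if i.val + j.val + 1 = 2 then (1 : L) else 0) ×
          UnitaryGroup.arch (↥(maximalRealSubfield L)) L (IsCMField.complexConj L) 1
            (Matrix.of fun i j : Fin 1 => if i.val + j.val + 1 = 1 then (1 : L) else 0)))
        (t' : ∀ γ' : UnitaryGroup.arch (↥(maximalRealSubfield L)) L (IsCMField.complexConj L) 3 H',
          Measure (Subgroup.centralizer ({γ'} : Set (UnitaryGroup.arch (↥(maximalRealSubfield L)) L (IsCMField.complexConj L) 3 H'))))
        (t : ∀ γ : UnitaryGroup.arch (↥(maximalRealSubfield L)) L (IsCMField.complexConj L) 3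
            (Matrix.of fun i j : Fin 3 => if i.val + j.val + 1 = 3 then (1 : L) else 0),
          Measure (Subgroup.centralizer ({γ} : Set (UnitaryGroup.arch (↥(maximalRealSubfield L)) L (IsCMField.complexConj L) 3
            (Matrix.of fun i j : Fin 3 => if i.val + j.val + 1 = 3 then (1 : L) else 0)))))
        (tH : ∀ γH : UnitaryGroup.arch (↥(maximalRealSubfield L)) L (IsCMField.complexConj L) 2
              (Matrix.of fun i j : Fin 2 => if i.val + j.val + 1 = 2 then (1 : L) else 0) ×
            UnitaryGroup.arch (↥(maximalRealSubfield L)) L (IsCMField.complexConj L) 1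
              (Matrix.of fun i j : Fin 1 => if i.val + j.val + 1 = 1 then (1 : L) else 0),
          Measure (Subgroup.centralizer ({γH} : Set (UnitaryGroup.arch (↥(maximalRealSubfield L)) L (IsCMField.complexConj L) 2
              (Matrix.of fun i j : Fin 2 => if i.val + j.val + 1 = 2 then (1 : L) else 0) ×
            UnitaryGroup.arch (↥(maximalRealSubfield L)) L (IsCMField.complexConj L) 1
              (Matrix.of fun i j : Fin 1 => if i.val + j.val + 1 = 1 then (1 : L) else 0))))),
      ArchCanonicalSingularMatrix L H' Tinf νGi νqi νHi hanis m' m mHi t' t tH →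
      ∃ μ : Literature.NumberTheory.GaloisRepresentations.HeckeCharacter L, μ.IsUnitary ∧
        (∀ x : Literature.NumberTheory.GaloisRepresentations.ideleGroup ↥(maximalRealSubfield L),
          μ (AdeleRing.ideleBaseChange (↥(maximalRealSubfield L)) L x) = quadraticHeckeCharCM L x) ∧
        (∃ (Sbad' : Finset (HeightOneSpectrum (𝓞 ↥(maximalRealSubfield L))))
           (mH' : ∀ v : HeightOneSpectrum (𝓞 ↥(maximalRealSubfield L)),
             OrbitalMeasureFamily ((UnitaryGroup.cmDatum L 2 (Matrix.of fun i j : Fin 2 => if i.val + j.val + 1 = 2 then (1 : L) else 0)).Local v ×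
               (UnitaryGroup.cmDatum L 1 (Matrix.of fun i j : Fin 1 => if i.val + j.val + 1 = 1 then (1 : L) else 0)).Local v))
           (mG' : ∀ v : HeightOneSpectrum (𝓞 ↥(maximalRealSubfield L)), OrbitalMeasureFamily ((UnitaryGroup.cmDatum L 3 H').Local v)),
           CanonicalTransferMatrix L H' (archCanonicalTransferFactor L H' μ).Δ νH νG Sbad'
             (finExplicitCollection L H' μ (finExplicitDelta_conj_left_all L H' μ) (finExplicitDelta_conj_right_all L H' μ)) mH' mG') ∧
        ArchCanonicalSingularMatrix L H' (archCanonicalTransferFactor L H' μ) νGi νqi νHi hanis m' m mHi t' t tH) :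
    (∀ T : ArchTransferFactor L H',
      type_of% (Summit.HodgeConjecture.HodgeConjecture.Cruxes.H413.K2E4SingularTransferKappaSign.ArchLimitConstant.sig_K2E4ExplicitArchSingularTransfer L H' T νH νG νGi νqi νHi)) →
    type_of% (Summit.HodgeConjecture.HodgeConjecture.Cruxes.H413.K2E4SingularTransferKappaSign.WeakMatrixRigidity.sig_K2E4WeakMatrixArchTransport L H' Tinf νH νG νGi νqi νHi) →
    type_of% (Summit.HodgeConjecture.HodgeConjecture.Cruxes.H413.K2E4SingularTransferKappaSign.stub_archSingularKappaTransfer L H' Tinf νH νG νGi νqi νHi) :=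
  fun h9 h21 =>
    Summit.HodgeConjecture.HodgeConjecture.Cruxes.H413.K2E4StubAOfSockets.stubA_of_sockets L H' Tinf νH νG νGi νqi νHi hE h9 h21

set_option maxHeartbeats 16000000 in
set_option synthInstance.maxHeartbeats 800000 in
set_option linter.unusedSectionVars false in
/-- **C1′ certificate — `stubC_of_sigs : ‹#1′› → ‹#22› → ‹stub C›` BY NAME.**  ‹#1′› = `SplitDescent.sig_K2E4ExplicitSplitSingularTransferU` (ED. 2), ‹#22› =
`WeakMatrixRigidity.sig_K2E4WeakMatrixFiniteTransport`, conclusion = the type of tier-0 `stub_finSingularKappaTransferSplit`; proof = ★ `K2E4StubCOfSockets.stubC_of_sockets`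
(K2E4-p17 p854908). -/
theorem stubC_of_sigs :
    type_of% (Summit.HodgeConjecture.HodgeConjecture.Cruxes.H413.K2E4SingularTransferKappaSign.SplitDescent.sig_K2E4ExplicitSplitSingularTransferU L H' Tinf νH νG νGi νqi νHi) →
    type_of% (Summit.HodgeConjecture.HodgeConjecture.Cruxes.H413.K2E4SingularTransferKappaSign.WeakMatrixRigidity.sig_K2E4WeakMatrixFiniteTransport L H' Tinf νH νG νGi νqi νHi) →
    type_of% (Summit.HodgeConjecture.HodgeConjecture.Cruxes.H413.K2E4SingularTransferKappaSign.stub_finSingularKappaTransferSplit L H' Tinf νH νG νGi νqi νHi) :=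
  fun h1 h22 =>
    Summit.HodgeConjecture.HodgeConjecture.Cruxes.H413.K2E4StubCOfSockets.stubC_of_sockets L H' Tinf νH νG νGi νqi νHi h1 h22

set_option maxHeartbeats 16000000 in
set_option synthInstance.maxHeartbeats 800000 in
set_option linter.unusedSectionVars false in
/-- **C1′ certificate over the SPLIT half — `stubC_of_sigsSplit : ‹#1′› → ‹#22S› → ‹stub C›` BY NAME (EDITION 5).**  ‹#1′› = `SplitDescent.sig_K2E4ExplicitSplitSingularTransferU`,
‹#22S› = `WeakMatrixRigidity.sig_K2E4WeakMatrixFiniteTransportSplit` (ED. 3), conclusion = the type of tier-0 `stub_finSingularKappaTransferSplit`; proof = ★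
`K2E4StubCOfSocketsSplit.stubC_of_socketsSplit` (K2E4-p17 (g2) p855380; hypothesis bytes = the closed socket statements verbatim).  Consequence for the box: stub C no longer
waits on the non-split half #22N (whose residue (RIG_v^ns)∕(WR_v) is NOT IN PRINT, REPORT-22 §5). -/
theorem stubC_of_sigsSplit :
    type_of% (Summit.HodgeConjecture.HodgeConjecture.Cruxes.H413.K2E4SingularTransferKappaSign.SplitDescent.sig_K2E4ExplicitSplitSingularTransferU L H' Tinf νH νG νGi νqi νHi) →
    type_of% (Summit.HodgeConjecture.HodgeConjecture.Cruxes.H413.K2E4SingularTransferKappaSign.WeakMatrixRigidity.sig_K2E4WeakMatrixFiniteTransportSplit L H' Tinf νH νG νGi νqi νHi) →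
    type_of% (Summit.HodgeConjecture.HodgeConjecture.Cruxes.H413.K2E4SingularTransferKappaSign.stub_finSingularKappaTransferSplit L H' Tinf νH νG νGi νqi νHi) :=
  fun h1 hS =>
    Summit.HodgeConjecture.HodgeConjecture.Cruxes.H413.K2E4StubCOfSocketsSplit.stubC_of_socketsSplit L H' Tinf νH νG νGi νqi νHi h1 hS

set_option maxHeartbeats 16000000 in
set_option synthInstance.maxHeartbeats 800000 in
set_option linter.unusedSectionVars false in
/-- **R13′ identity certificate — `stubAR_of_sigs : ‹#9› → ‹A_R›` is `fun h => h`.**  The pinned twin A_R `stub_archSingularKappaTransferR` (tier-0 ED. 2 :485) has the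
bytes of socket #9 `ArchLimitConstant.sig_K2E4ExplicitArchSingularTransfer` token for token («A_R = #9 by name + nothing», chair R13′ (1)). -/
theorem stubAR_of_sigs :
    type_of% (Summit.HodgeConjecture.HodgeConjecture.Cruxes.H413.K2E4SingularTransferKappaSign.ArchLimitConstant.sig_K2E4ExplicitArchSingularTransfer L H' Tinf νH νG νGi νqi νHi) →
    type_of% (Summit.HodgeConjecture.HodgeConjecture.Cruxes.H413.K2E4SingularTransferKappaSign.stub_archSingularKappaTransferR L H' Tinf νH νG νGi νqi νHi) :=
  fun h => h

set_option maxHeartbeats 16000000 in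
set_option synthInstance.maxHeartbeats 800000 in
set_option linter.unusedSectionVars false in
/-- **R13′ identity certificate — `stubBR_of_sigs : ‹#14› → ‹B_R›` is `fun h => h`.**  The pinned twin B_R `stub_kappaSignOfPinnedConstantsR` (tier-0 ED. 2 :557) has the
bytes of socket #14 `SingularProductFormula.sig_K2E4ExplicitKappaSign` token for token («B_R := #14's bytes by name, no new content», chair R13′ (1)); so K2E4-p14's ★
`Theorems/K2E4ExplicitKappaSignOfSockets` (p854898: ‹#2› → ‹#8› → ‹#13R› → ‹#10♯› → ‹#14›) is ALREADY the composition cert of B_R from its sockets. -/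
theorem stubBR_of_sigs :
    type_of% (Summit.HodgeConjecture.HodgeConjecture.Cruxes.H413.K2E4SingularTransferKappaSign.SingularProductFormula.sig_K2E4ExplicitKappaSign L H' Tinf νH νG νGi νqi νHi) →
    type_of% (Summit.HodgeConjecture.HodgeConjecture.Cruxes.H413.K2E4SingularTransferKappaSign.stub_kappaSignOfPinnedConstantsR L H' Tinf νH νG νGi νqi νHi) :=
  fun h => h

set_option maxHeartbeats 16000000 in
set_option synthInstance.maxHeartbeats 800000 in
set_option linter.unusedSectionVars false in
/-- **B_R composition certificate — `stubBR_of_sockets4 : ‹#2› → ‹#8› → ‹#13R› → ‹#10♯› → ‹stub B_R›` BY NAME.**  ‹#2› = `SplitDescent.sig_K2E4ExplicitSplitConstantPhase`,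
‹#8› = `FinGermConstants.sig_K2E4KottwitzSignOfSheets`, ‹#13R› = `ArchLimitConstant.sig_K2E4ArchTransferValueNonvanishingR`, ‹#10♯› =
`ArchLimitConstant.sig_K2E4ExplicitArchConstantPhaseSigned` (ED. 5), conclusion = the type of tier-0 `stub_kappaSignOfPinnedConstantsR` (≡ #14); proof = ★
`K2E4ExplicitKappaSignOfSockets.explicitKappaSign_of_sockets` (K2E4-p14 p854898; consumes BY NAME inside ★ #6♯, #16, #17, #18, J4∕J0, `explicitKappaSign_of_phasePins`,
the one-class Haar-ratio transport), the four socket hypotheses instantiated at the common frame + pinned-data prefix. -/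
theorem stubBR_of_sockets4 :
    type_of% (Summit.HodgeConjecture.HodgeConjecture.Cruxes.H413.K2E4SingularTransferKappaSign.SplitDescent.sig_K2E4ExplicitSplitConstantPhase L H' Tinf νH νG νGi νqi νHi) →
    type_of% (Summit.HodgeConjecture.HodgeConjecture.Cruxes.H413.K2E4SingularTransferKappaSign.FinGermConstants.sig_K2E4KottwitzSignOfSheets L H' Tinf νH νG νGi νqi νHi) →
    type_of% (Summit.HodgeConjecture.HodgeConjecture.Cruxes.H413.K2E4SingularTransferKappaSign.ArchLimitConstant.sig_K2E4ArchTransferValueNonvanishingR L H' Tinf νH νG νGi νqi νHi) →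
    type_of% (Summit.HodgeConjecture.HodgeConjecture.Cruxes.H413.K2E4SingularTransferKappaSign.ArchLimitConstant.sig_K2E4ExplicitArchConstantPhaseSigned L H' Tinf νH νG νGi νqi νHi) →
    type_of% (Summit.HodgeConjecture.HodgeConjecture.Cruxes.H413.K2E4SingularTransferKappaSign.stub_kappaSignOfPinnedConstantsR L H' Tinf νH νG νGi νqi νHi) := by
  intro h2 h8 h13 h10 hK hanis Sbad Δ mH mG m' m mHi t' t tH hherm hCTM hACS μ hμu hμω hΔ hTinf
  exact Summit.HodgeConjecture.HodgeConjecture.Cruxes.H413.K2E4ExplicitKappaSignOfSockets.explicitKappaSign_of_sockets L H' Tinf νH νG νGi νqi νHi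
    hK hanis Sbad Δ mH mG m' m mHi t' t tH hherm hCTM hACS μ hμu hμω hΔ hTinf (h2 hK hanis Sbad Δ mH mG m' m mHi t' t tH hherm hCTM hACS μ hμu hμω hΔ hTinf) (h8 hK hanis Sbad Δ mH mG m' m mHi t' t tH hherm hCTM hACS μ hμu hμω hΔ hTinf) (h13 hK hanis Sbad Δ mH mG m' m mHi t' t tH hherm hCTM hACS μ hμu hμω hΔ hTinf) (h10 hK hanis Sbad Δ mH mG m' m mHi t' t tH hherm hCTM hACS μ hμu hμω hΔ hTinf)

set_option linter.unusedSectionVars false in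
/-- **#22 from its two halves — `sig22_of_halves : ‹#22S› → ‹#22N› → ‹#22›` (EDITION 4; dealer re-cut of K2E4-p18 (g2) REPORT-22).**  ‹#22S› =
`WeakMatrixRigidity.sig_K2E4WeakMatrixFiniteTransportSplit` (guard `¬ Subsingleton (UnitaryGroup.PlacesOver L v)`), ‹#22N› = `…Nonsplit` (guard `Subsingleton …`),
conclusion = the type of #22 `WeakMatrixRigidity.sig_K2E4WeakMatrixFiniteTransport`; proof = `by_cases` on the guard at the place `v`.  So #22 is CLOSED RELATIVE to
its halves (kernel-checked here; #22's own `sorry` in the Sigs module stays until the chair's re-tie policy ruling). -/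
theorem sig22_of_halves :
    type_of% (Summit.HodgeConjecture.HodgeConjecture.Cruxes.H413.K2E4SingularTransferKappaSign.WeakMatrixRigidity.sig_K2E4WeakMatrixFiniteTransportSplit L H' Tinf νH νG νGi νqi νHi) →
    type_of% (Summit.HodgeConjecture.HodgeConjecture.Cruxes.H413.K2E4SingularTransferKappaSign.WeakMatrixRigidity.sig_K2E4WeakMatrixFiniteTransportNonsplit L H' Tinf νH νG νGi νqi νHi) →
    type_of% (Summit.HodgeConjecture.HodgeConjecture.Cruxes.H413.K2E4SingularTransferKappaSign.WeakMatrixRigidity.sig_K2E4WeakMatrixFiniteTransport L H' Tinf νH νG νGi νqi νHi) := by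
  intro hS hN hK hanis Sbad Δ mH mG m' m mHi t' t tH hherm hCTM hACS μ hμu hμω mGs₀ hQ γ₀ e₁ e₂ hne hγ hnc hchar γH hγ1 hγ2 v hloc
  by_cases hs : Subsingleton (UnitaryGroup.PlacesOver L v)
  · exact hN hK hanis Sbad Δ mH mG m' m mHi t' t tH hherm hCTM hACS μ hμu hμω mGs₀ hQ γ₀ e₁ e₂ hne hγ hnc hchar γH hγ1 hγ2 v hs hloc
  · exact hS hK hanis Sbad Δ mH mG m' m mHi t' t tH hherm hCTM hACS μ hμu hμω mGs₀ hQ γ₀ e₁ e₂ hne hγ hnc hchar γH hγ1 hγ2 v hs hloc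

/-- BY-NAME PLUG (sanity, no new content; `example`s add no constants and no proof holes of their own — the sockets' holes live in the `…Sigs*` modules):
the certificates applied to the ACTUAL socket theorems give terms of the ACTUAL stub types. -/
example     (hE' : ∀
        (hanis : ∀ x : Fin 3 → L, hermForm (cmConjRingHom L) H' x x = 0 → x = 0)
        (m' : OrbitalMeasureFamily (UnitaryGroup.arch (↥(maximalRealSubfield L)) L (IsCMField.complexConj L) 3 H'))
        (m : OrbitalMeasureFamily (UnitaryGroup.arch (↥(maximalRealSubfield L)) L (IsCMField.complexConj L) 3
          (Matrix.of fun i j : Fin 3 => if i.val + j.val + 1 = 3 then (1 : L) else 0)))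
        (mHi : OrbitalMeasureFamily (UnitaryGroup.arch (↥(maximalRealSubfield L)) L (IsCMField.complexConj L) 2
            (Matrix.of fun i j : Fin 2 => if i.val + j.val + 1 = 2 then (1 : L) else 0) ×
          UnitaryGroup.arch (↥(maximalRealSubfield L)) L (IsCMField.complexConj L) 1
            (Matrix.of fun i j : Fin 1 => if i.val + j.val + 1 = 1 then (1 : L) else 0)))
        (t' : ∀ γ' : UnitaryGroup.arch (↥(maximalRealSubfield L)) L (IsCMField.complexConj L) 3 H',
          Measure (Subgroup.centralizer ({γ'} : Set (UnitaryGroup.arch (↥(maximalRealSubfield L)) L (IsCMField.complexConj L) 3 H'))))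
        (t : ∀ γ : UnitaryGroup.arch (↥(maximalRealSubfield L)) L (IsCMField.complexConj L) 3
            (Matrix.of fun i j : Fin 3 => if i.val + j.val + 1 = 3 then (1 : L) else 0),
          Measure (Subgroup.centralizer ({γ} : Set (UnitaryGroup.arch (↥(maximalRealSubfield L)) L (IsCMField.complexConj L) 3
            (Matrix.of fun i j : Fin 3 => if i.val + j.val + 1 = 3 then (1 : L) else 0)))))
        (tH : ∀ γH : UnitaryGroup.arch (↥(maximalRealSubfield L)) L (IsCMField.complexConj L) 2
              (Matrix.of fun i j : Fin 2 => if i.val + j.val + 1 = 2 then (1 : L) else 0) ×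
            UnitaryGroup.arch (↥(maximalRealSubfield L)) L (IsCMField.complexConj L) 1
              (Matrix.of fun i j : Fin 1 => if i.val + j.val + 1 = 1 then (1 : L) else 0),
          Measure (Subgroup.centralizer ({γH} : Set (UnitaryGroup.arch (↥(maximalRealSubfield L)) L (IsCMField.complexConj L) 2
              (Matrix.of fun i j : Fin 2 => if i.val + j.val + 1 = 2 then (1 : L) else 0) ×
            UnitaryGroup.arch (↥(maximalRealSubfield L)) L (IsCMField.complexConj L) 1
              (Matrix.of fun i j : Fin 1 => if i.val + j.val + 1 = 1 then (1 : L) else 0))))),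
      ArchCanonicalSingularMatrix L H' Tinf νGi νqi νHi hanis m' m mHi t' t tH →
      ∃ μ : Literature.NumberTheory.GaloisRepresentations.HeckeCharacter L, μ.IsUnitary ∧
        (∀ x : Literature.NumberTheory.GaloisRepresentations.ideleGroup ↥(maximalRealSubfield L),
          μ (AdeleRing.ideleBaseChange (↥(maximalRealSubfield L)) L x) = quadraticHeckeCharCM L x) ∧
        (∃ (Sbad' : Finset (HeightOneSpectrum (𝓞 ↥(maximalRealSubfield L))))
           (mH' : ∀ v : HeightOneSpectrum (𝓞 ↥(maximalRealSubfield L)),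
             OrbitalMeasureFamily ((UnitaryGroup.cmDatum L 2 (Matrix.of fun i j : Fin 2 => if i.val + j.val + 1 = 2 then (1 : L) else 0)).Local v ×
               (UnitaryGroup.cmDatum L 1 (Matrix.of fun i j : Fin 1 => if i.val + j.val + 1 = 1 then (1 : L) else 0)).Local v))
           (mG' : ∀ v : HeightOneSpectrum (𝓞 ↥(maximalRealSubfield L)), OrbitalMeasureFamily ((UnitaryGroup.cmDatum L 3 H').Local v)),
           CanonicalTransferMatrix L H' (archCanonicalTransferFactor L H' μ).Δ νH νG Sbad'
             (finExplicitCollection L H' μ (finExplicitDelta_conj_left_all L H' μ) (finExplicitDelta_conj_right_all L H' μ)) mH' mG') ∧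
        ArchCanonicalSingularMatrix L H' (archCanonicalTransferFactor L H' μ) νGi νqi νHi hanis m' m mHi t' t tH) :
    type_of% (Summit.HodgeConjecture.HodgeConjecture.Cruxes.H413.K2E4SingularTransferKappaSign.stub_archSingularKappaTransfer L H' Tinf νH νG νGi νqi νHi) :=
  stubA_of_sigs L H' Tinf νH νG νGi νqi νHi hE'
    (fun T => Summit.HodgeConjecture.HodgeConjecture.Cruxes.H413.K2E4SingularTransferKappaSign.ArchLimitConstant.sig_K2E4ExplicitArchSingularTransfer L H' T νH νG νGi νqi νHi)
    (Summit.HodgeConjecture.HodgeConjecture.Cruxes.H413.K2E4SingularTransferKappaSign.WeakMatrixRigidity.sig_K2E4WeakMatrixArchTransport L H' Tinf νH νG νGi νqi νHi)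

example : type_of% (Summit.HodgeConjecture.HodgeConjecture.Cruxes.H413.K2E4SingularTransferKappaSign.stub_finSingularKappaTransferNonsplit L H' Tinf νH νG νGi νqi νHi) :=
  stubD_of_sigs L H' Tinf νH νG νGi νqi νHi
    (Summit.HodgeConjecture.HodgeConjecture.Cruxes.H413.K2E4SingularTransferKappaSign.FinSingularTransferExplicit.sig_K2E4ExplicitNonsplitSingularTransferU L H' Tinf νH νG νGi νqi νHi)
    (Summit.HodgeConjecture.HodgeConjecture.Cruxes.H413.K2E4SingularTransferKappaSign.WeakMatrixRigidity.sig_K2E4WeakMatrixFiniteTransport L H' Tinf νH νG νGi νqi νHi)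

example : type_of% (Summit.HodgeConjecture.HodgeConjecture.Cruxes.H413.K2E4SingularTransferKappaSign.stub_finSingularKappaTransferSplit L H' Tinf νH νG νGi νqi νHi) :=
  stubC_of_sigs L H' Tinf νH νG νGi νqi νHi
    (Summit.HodgeConjecture.HodgeConjecture.Cruxes.H413.K2E4SingularTransferKappaSign.SplitDescent.sig_K2E4ExplicitSplitSingularTransferU L H' Tinf νH νG νGi νqi νHi)
    (Summit.HodgeConjecture.HodgeConjecture.Cruxes.H413.K2E4SingularTransferKappaSign.WeakMatrixRigidity.sig_K2E4WeakMatrixFiniteTransport L H' Tinf νH νG νGi νqi νHi)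

example : type_of% (Summit.HodgeConjecture.HodgeConjecture.Cruxes.H413.K2E4SingularTransferKappaSign.stub_archSingularKappaTransferR L H' Tinf νH νG νGi νqi νHi) :=
  Summit.HodgeConjecture.HodgeConjecture.Cruxes.H413.K2E4SingularTransferKappaSign.ArchLimitConstant.sig_K2E4ExplicitArchSingularTransfer L H' Tinf νH νG νGi νqi νHi

example : type_of% (Summit.HodgeConjecture.HodgeConjecture.Cruxes.H413.K2E4SingularTransferKappaSign.stub_kappaSignOfPinnedConstantsR L H' Tinf νH νG νGi νqi νHi) :=
  Summit.HodgeConjecture.HodgeConjecture.Cruxes.H413.K2E4SingularTransferKappaSign.SingularProductFormula.sig_K2E4ExplicitKappaSign L H' Tinf νH νG νGi νqi νHi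

example : type_of% (Summit.HodgeConjecture.HodgeConjecture.Cruxes.H413.K2E4SingularTransferKappaSign.stub_kappaSignOfPinnedConstantsR L H' Tinf νH νG νGi νqi νHi) :=
  stubBR_of_sockets4 L H' Tinf νH νG νGi νqi νHi
    (Summit.HodgeConjecture.HodgeConjecture.Cruxes.H413.K2E4SingularTransferKappaSign.SplitDescent.sig_K2E4ExplicitSplitConstantPhase L H' Tinf νH νG νGi νqi νHi)
    (Summit.HodgeConjecture.HodgeConjecture.Cruxes.H413.K2E4SingularTransferKappaSign.FinGermConstants.sig_K2E4KottwitzSignOfSheets L H' Tinf νH νG νGi νqi νHi)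
    (Summit.HodgeConjecture.HodgeConjecture.Cruxes.H413.K2E4SingularTransferKappaSign.ArchLimitConstant.sig_K2E4ArchTransferValueNonvanishingR L H' Tinf νH νG νGi νqi νHi)
    (Summit.HodgeConjecture.HodgeConjecture.Cruxes.H413.K2E4SingularTransferKappaSign.ArchLimitConstant.sig_K2E4ExplicitArchConstantPhaseSigned L H' Tinf νH νG νGi νqi νHi)

end Frame

end Summit.HodgeConjecture.HodgeConjecture.Cruxes.H413.K2E4SingularTransferKappaSign.Compositions

end
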